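import Summits.BirchSwinnertonDyer.Rank1Residual.F1Sign2.TwistLatticeAtTwo
import Literature.NumberTheory.EllipticCurves.CongruenceNumber
import Literature.NumberTheory.EllipticCurves.ModularSymbolsLattice
import Literature.NumberTheory.EllipticCurves.Selmer
import Literature.NumberTheory.EllipticCurves.QuadraticTwist
import HarnessLib

/-!
# ES-34 (-es g25) — the 2-adic floor of the modular degree is the ANATOMY OF THE ADJOINT L-VALUE
# (sketch; crux `RankOneAtTwoBigImageOddLocal` = stmt-BirchSwinnertonDyer-23715)

PRINT (m-currency).  Watkins, *Computing the modular degree of an elliptic curve*, Experiment. Math. 11 (2002),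
(1-1) and §2 [corpus:paper:doi-10-1080-10586458-2002-10504701 p2, p5–7] (Flach 1993, Shimura 1976, Zagier 1985,
Coates–Schmidt 1987): `deg φ_E = N c² L^A(Sym² E, 2)/(π i Ω_E)` with `L^A = L^M · ∏_{p² ∣ N} U_p(s)`; under a quadratic
twist `E = F ⊗ χ`, `deg φ_E = deg φ_F (c_E/c_F)² ∏_p V_p` with, at an odd `p ∣ cond χ`: `V_p = (p−1)(p+1−a_p)(p+1+a_p)`
(`F` good at `p`), `(p−1)(p+1)` (`F` multiplicative), `p` (`F` additive); at a twist-MINIMAL additive `p ≥ 5`: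
`U_p(2)⁻¹ = (p − ε'_p)/p` with `ε'_p = +1` iff `ℚ_p(F[3])/ℚ_p` is abelian (Thm 2.1 / Cor 2.2).
DATA (ENGINE 34 = pure-integer pass over the -es g23/g24 tables: 38 042 optimal curves `N ≤ 10⁴` with `deg`, `dim Sel₂`,
local data; 6 549 with the congruence number `r`): the twist formula is EXACT in `v₂(deg)` on 16 360 / 16 360 pairs;
the new laws below are what is NOT in print.  Currency: `m` = modular degree of the optimal curve, `r` = congruence number
of the newform.  Nothing here is a theorem beyond print; BSD is not proved.
-/

open scoped Classical AddSubgroup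

noncomputable section

set_option linter.dupNamespace false
set_option autoImplicit false

namespace Summit.BirchSwinnertonDyer.BirchSwinnertonDyer.Theorems.RankOneAtTwoSymSquareAnatomy

open Literature.NumberTheory.EllipticCurves Literature.NumberTheory.EllipticCurves.ModularForms WeierstrassCurve
open Summit.BirchSwinnertonDyer.BirchSwinnertonDyer.Theorems.RankOneAtTwoTwistLattice (primeCount primeStar)

/-! ## The local units -/

/-- The order `e_p = 12 / gcd(12, v_p(Δ_min))` of the inertia image at a prime `p ≥ 5` of additive, potentially good
reduction of a GLOBALLY MINIMAL `W` (Serre 1972 §5.6); `e_p ∈ {3, 4, 6}` exactly when `W` is `p`-twist-minimal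
(Kodaira `IV, III, II`). [cite: Serre1972, §5.6] -/
def inertiaOrderAt (W : WeierstrassCurve ℚ) (p : ℕ) : ℕ := 12 / Nat.gcd 12 (padicValRat p W.Δ).toNat

/-- Watkins' sign `ε'_p ∈ {+1, −1}` of the motivic Euler factor `L^M_p(Sym² E, s) = (1 − ε'_p p^{1−s})⁻¹` at a twist-minimal
additive prime `p ≥ 5`: `ε'_p = +1` iff `ℚ_p(E[3])/ℚ_p` is abelian iff `μ_{e_p} ⊂ ℚ_p` iff `p ≡ 1 (mod e_p)`
(Watkins 2002 Thm 2.1; the elementary form Cor. 2.2: `p ≡ 1 (12)`: `+1`; `p ≡ 11 (12)`: `−1`; `p ≡ 5 (12)`: `+1` iff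
`p² ∣ c₆ ∧ p ∥ c₄`; `p ≡ 7 (12)`: `−1` iff `p² ∣ c₆ ∧ p ∥ c₄`).  [cite: Watkins2002ModularDegree, Thm 2.1, Cor 2.2] -/
def symSquareSignAt (W : WeierstrassCurve ℚ) (p : ℕ) : ℤ := if p % inertiaOrderAt W p = 1 then 1 else -1

/-- The TORUS UNIT `λ_p(W) = v₂(p − ε'_p(W)) = v₂(p · U_p(2)⁻¹)` of a twist-minimal additive prime `p ≥ 5`
(`= v₂(#T(𝔽_p))` for the one-dimensional torus `T` split iff `μ_{e_p} ⊂ 𝔽_p`). -/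
def torusUnitAt (W : WeierstrassCurve ℚ) (p : ℕ) : ℕ :=
  if symSquareSignAt W p = 1 then padicValNat 2 (p - 1) else padicValNat 2 (p + 1)

/-- The local `2`-adic degree unit `λ_p` of an ODD prime `p ∣ N`: `1` at a multiplicative prime (the Atkin–Lehner unit);
at `p = 3` additive: `2` if `v₃(N) = 2` (`U₃(2) = 3/4`, Watkins §2.2.2) else `1`; at an additive `p ≥ 5`: the torus unit. -/
def localDegreeUnit (W : WeierstrassCurve ℚ) (N p : ℕ) : ℕ :=
  if ¬ p ^ 2 ∣ N then 1 else if p = 3 then (if ¬ 3 ^ 3 ∣ N then 2 else 1) else torusUnitAt W p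

/-- `Λ_odd(W) = Σ_{p ∣ N, p odd} λ_p(W)`. -/
def oddUnitSum (W : WeierstrassCurve ℚ) (N : ℕ) : ℕ :=
  ∑ p ∈ N.primeFactors.filter (fun p => p ≠ 2), localDegreeUnit W N p

/-- The `2`-adic unit of the modular-degree floor as a function of `v = v₂(N)`: `0, 1, 0, 2, 2, 3, 3, 4, 4` for `v = 0 … 8`
(`[2 ∣ N] + g(v)` with `g = ⌈v/2⌉ − 1` for `v ≥ 3` and the dip allowance `g(2) = −1`; ES-32 B♯ / ES-33E). -/
def twoAdicDegreeUnit (v : ℕ) : ℕ := if v = 0 ∨ v = 2 then 0 else if v = 1 then 1 else (v + 1) / 2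

/-- The `2`-adic unit of the CONGRUENCE-NUMBER floor: `0, 1, 1, 3, 4, 5, 6, 7, 8` for `v = 0 … 8` (`[2 ∣ N] + (v − 1)` for
`v ≥ 3`, no dip; ES-33E `CongruenceNumberConductorFloor`). -/
def twoAdicCongruenceUnit (v : ℕ) : ℕ := if v = 0 then 0 else if v ≤ 2 then 1 else v

/-- `W` is (globally) twist-minimal: no quadratic twist has smaller conductor. -/
def IsTwistMinimal (W : WeierstrassCurve ℚ) [W.IsElliptic] : Prop :=
  ∀ (d : ℚ) [(W.quadraticTwist d).IsElliptic], W.conductorNorm ℤ ≤ (W.quadraticTwist d).conductorNorm ℤ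

/-! ## ES-34U — the motivic Euler factor floor (conjecture; -es g25 P34.7, CONFIRMED 820/822, the 2 exceptions have an odd isogeny) -/

/-- **ES-34U `MotivicEulerFactorFloor` — v1, REFUTED IN DATA as typed (the seat's own mutation pass, -es g25 addendum: the STARRED tie
partner `6962e1`, see `MotivicEulerFactorFloorR` below, which supersedes it; kept as the recorded negative).**  For an optimal, twist-minimal, non-CM
`E/ℚ` with `ρ̄_{E,2}` surjective and no odd-degree rational isogeny,
`v₂(m_E) + 1 ≥ dim_{𝔽₂} Sel₂(E) + u₂(v₂ N) + Σ_{p ∣ N odd} λ_p(E)`: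
the Atkin–Lehner term `ω(N) − 1` of the ES-32/33 floor is NOT flat — a twist-minimal additive prime `p ≥ 5` contributes
`λ_p = v₂(p − ε'_p)`, the `2`-part of the inverse MOTIVIC Euler factor `p·U_p(2)⁻¹ = p − ε'_p` of `L(Sym² E, s)` at `s = 2`
(e.g. `+4` at `p = 17` of Kodaira type `II`/`IV`, `+5` at `p = 31` of type `III`).  ENGINE 34 (N ≤ 10⁴, 14 097 twist-minimal
`S₃`-curves, 822 with `Σ(λ_p − 1) > 0`): 820 satisfy it, 188 with equality; the 2 exceptions `338a1` (`7`-isogeny), `1058c1`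
(`3`-isogeny) are excluded by the isogeny hypothesis; multiplicative primes stay flat (`λ_p = 1` for every `p mod 8`, `w_p`).
Why it might fail: a twist-minimal curve beyond `10⁴` with `v₂(m_E) + 1 − s − u₂ − Σλ_p < 0`, most plausibly at a prime
`p ≡ ±1 (mod 32)`; or the isogeny guard is not the right one (only 2 witnesses).  Reading: `v₂(N c² L^M(Sym² E,2)/(π i Ω_E) /
∏_{p² ∣ N} p) ≥ dim Sel₂(E) + …` — integrality of the motivic adjoint `L`-value at `2` with its Bloch–Kato Selmer term
(Flach's theorem is prime-to-`2`; open at `2`). [cite: Watkins2002ModularDegree, (1-1), Thm 2.1; Flach1993] -/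
@[conjecture] def MotivicEulerFactorFloor : Prop :=
  ∀ (W : WeierstrassCurve ℚ) [W.IsElliptic] [W.IsGloballyMinimal] [NeZero (W.conductorNorm ℤ)]
    (D : ModularParametrizationData W (W.conductorNorm ℤ)),
    (∀ (W'' : WeierstrassCurve ℚ) [W''.IsElliptic] (D'' : ModularParametrizationData W'' (W.conductorNorm ℤ)),
        D''.f = D.f → D.modularDegree ≤ D''.modularDegree) →
    ¬ W.HasCM → W.HasSurjectiveModNGaloisRep ((2 : ℕ) : ℤ) →
    (∀ ℓ : ℕ, ℓ.Prime → ℓ ≠ 2 → W.HasIrreducibleModPGaloisRep ℓ) → IsTwistMinimal W →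
    Nat.card (W.selmerGroup 2) *
        2 ^ (twoAdicDegreeUnit (padicValNat 2 (W.conductorNorm ℤ)) + oddUnitSum W (W.conductorNorm ℤ))
      ≤ 2 * 2 ^ padicValNat 2 D.modularDegree

/-- **ES-34U♯ `MotivicEulerFactorCongruenceFloor` — v1 (conductor-minimal only; superseded by `MotivicEulerFactorCongruenceFloorR`:
no `r`-currency violation is known on starred partners (49 with `r`), but the `m`-currency witness `6962e1` makes the unstarred
hypothesis the honest one).**  Same law for
the congruence number with the dip-free, linear `2`-adic unit of ES-33E: `v₂(r_E) + 1 ≥ dim Sel₂(E) + u₂ʳ(v₂ N) + Σ_{p odd} λ_p(E)`.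
ENGINE 34: 2 403 twist-minimal `S₃`-curves with `r` known, 2 exceptions = the same two isogenous curves.
Why it might fail: as ES-34U, plus the `v − 1` growth of the `2`-adic unit beyond `N ≤ 10⁴`. [cite: Watkins2002ModularDegree; AgasheRibetStein2012] -/
@[conjecture] def MotivicEulerFactorCongruenceFloor : Prop :=
  ∀ (W : WeierstrassCurve ℚ) [W.IsElliptic] [W.IsGloballyMinimal] [NeZero (W.conductorNorm ℤ)]
    (D : ModularParametrizationData W (W.conductorNorm ℤ)),
    ¬ W.HasCM → W.HasSurjectiveModNGaloisRep ((2 : ℕ) : ℤ) →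
    (∀ ℓ : ℕ, ℓ.Prime → ℓ ≠ 2 → W.HasIrreducibleModPGaloisRep ℓ) → IsTwistMinimal W →
    Nat.card (W.selmerGroup 2) *
        2 ^ (twoAdicCongruenceUnit (padicValNat 2 (W.conductorNorm ℤ)) + oddUnitSum W (W.conductorNorm ℤ))
      ≤ 2 * 2 ^ padicValNat 2 (congruenceNumber D.f)

/-! ### ES-34U-R — the representative matters (addendum, -es g25): the law is read on the NON-STARRED member of each tie

Every curve with an additive `p ≥ 5` of Kodaira type `II, III, IV, IV*, III*, II*` has the conductor-tie twist partner `E ⊗ χ_{p*}`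
(`II ↔ IV*`, `III ↔ III*`, `IV ↔ II*`): same `N`, same `v₂(m)` (Watkins `V_p = p`), same `λ_p` (`Sym²` is twist-invariant), but a
different `2`-Selmer group.  ENGINE 34 tested Sage's minimal twist, which is ALWAYS the non-starred member (`v_p(Δ_min) < 6` at every
additive `p ≥ 5`: 1 735 / 1 735).  Mutation pass over the 3 220 conductor-tie partners in the table (`N ≤ 10⁴`, `S₃`, non-CM): the
conductor-minimal law fails ONCE without an isogeny excuse — `6962e1` (`N = 2·59²`, type `IV*` at `59`, rank `0`, `Ш_an = 4`, `dim Sel₂ = 2`,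
`v₂(m) = 3`, `λ₅₉ = v₂(60) = 2`: `3 + 1 < 2 + 1 + 2`), whose non-starred partner `6962l1` (type `II`, rank `1`, `dim Sel₂ = 1`) satisfies it.
Repaired census (conductor-minimal ∧ non-starred ∧ no odd isogeny ∧ `S₃` ∧ non-CM, `v₂(N) ≤ 8`): 13 995 curves, 1 045 with `Σ(λ_p − 1) + [v₃N = 2] > 0`,
0 violations, 201 equalities (`r`-currency: 119 with `r` known, 0 violations); on the 1 223 STARRED partners: 489 charged, 1 violation (`6962e1`), 84
equalities — so the law is NOT claimed there.  Twist-invariant corollary (weaker, implied): for every conductor-minimal `W`,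
`v₂(m_W) + 1 ≥ min_{W' ∈ tie(W)} dim Sel₂(W') + u₂(v₂N) + Σλ_p`. -/

/-- **ES-34U-R `MotivicEulerFactorFloorR` (this lens, -es g25 addendum; conjecture, m-currency; supersedes `MotivicEulerFactorFloor`).**
ES-34U with the representative pinned as Watkins' `p`-minimal twist: `v_p(Δ_min) < 6` (Kodaira `II`, `III` or `IV`) at every additive `p ≥ 5`.
Census above (1 045 charged curves, 0 violations, 201 equalities).  Why it might fail: as ES-34U; and the non-starred selector may itself be a
proxy (one starred witness only) for the true Selmer term, the Bloch–Kato Selmer group of `Ad⁰` at `2`, which is twist-invariant.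
[cite: Watkins2002ModularDegree, (1-1), Thm 2.1, Cor 2.2] -/
@[conjecture] def MotivicEulerFactorFloorR : Prop :=
  ∀ (W : WeierstrassCurve ℚ) [W.IsElliptic] [W.IsGloballyMinimal] [NeZero (W.conductorNorm ℤ)]
    (D : ModularParametrizationData W (W.conductorNorm ℤ)),
    (∀ (W'' : WeierstrassCurve ℚ) [W''.IsElliptic] (D'' : ModularParametrizationData W'' (W.conductorNorm ℤ)),
        D''.f = D.f → D.modularDegree ≤ D''.modularDegree) →
    ¬ W.HasCM → W.HasSurjectiveModNGaloisRep ((2 : ℕ) : ℤ) →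
    (∀ ℓ : ℕ, ℓ.Prime → ℓ ≠ 2 → W.HasIrreducibleModPGaloisRep ℓ) → IsTwistMinimal W →
    (∀ p : ℕ, p.Prime → 5 ≤ p → p ^ 2 ∣ W.conductorNorm ℤ → (padicValRat p W.Δ).toNat < 6) →
    Nat.card (W.selmerGroup 2) *
        2 ^ (twoAdicDegreeUnit (padicValNat 2 (W.conductorNorm ℤ)) + oddUnitSum W (W.conductorNorm ℤ))
      ≤ 2 * 2 ^ padicValNat 2 D.modularDegree

/-- **ES-34U♯-R `MotivicEulerFactorCongruenceFloorR` (conjecture, r-currency; supersedes `MotivicEulerFactorCongruenceFloor`).** -/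
@[conjecture] def MotivicEulerFactorCongruenceFloorR : Prop :=
  ∀ (W : WeierstrassCurve ℚ) [W.IsElliptic] [W.IsGloballyMinimal] [NeZero (W.conductorNorm ℤ)]
    (D : ModularParametrizationData W (W.conductorNorm ℤ)),
    ¬ W.HasCM → W.HasSurjectiveModNGaloisRep ((2 : ℕ) : ℤ) →
    (∀ ℓ : ℕ, ℓ.Prime → ℓ ≠ 2 → W.HasIrreducibleModPGaloisRep ℓ) → IsTwistMinimal W →
    (∀ p : ℕ, p.Prime → 5 ≤ p → p ^ 2 ∣ W.conductorNorm ℤ → (padicValRat p W.Δ).toNat < 6) →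
    Nat.card (W.selmerGroup 2) *
        2 ^ (twoAdicCongruenceUnit (padicValNat 2 (W.conductorNorm ℤ)) + oddUnitSum W (W.conductorNorm ℤ))
      ≤ 2 * 2 ^ padicValNat 2 (congruenceNumber D.f)

/-- The v1 law implies the repaired one (it only adds a hypothesis) — glue for provers / refuters. -/
theorem motivicEulerFactorFloorR_of_v1 (h : MotivicEulerFactorFloor) : MotivicEulerFactorFloorR := by
  intro W _ _ _ D hopt hcm h2 hirr hmin _hns
  exact h W D hopt hcm h2 hirr hmin

theorem motivicEulerFactorCongruenceFloorR_of_v1 (h : MotivicEulerFactorCongruenceFloor) :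
    MotivicEulerFactorCongruenceFloorR := by
  intro W _ _ _ D hcm h2 hirr hmin _hns
  exact h W D hcm h2 hirr hmin

/-! ## ES-34V/W — the odd-twist shift: print in m-currency, new in r-currency -/

/-- The `2`-adic Watkins–Zagier shift `v₂(V_p)` of an odd prime `p` at which `W` (globally minimal) is good or multiplicative:
`v₂((p−1)(p+1−a_p)(p+1+a_p))` resp. `v₂(p²−1)`; `0` at an additive (twist-minimal) `p`. -/
def oddTwistShift (W : WeierstrassCurve ℚ) [W.IsGloballyMinimal] (N p : ℕ) : ℕ :=
  if p ^ 2 ∣ N then 0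
  else if p ∣ N then padicValNat 2 (p ^ 2 - 1)
  else padicValNat 2 (p - 1) + padicValNat 2 ((((p : ℤ) + 1) ^ 2 - (W.frobeniusTrace p) ^ 2).natAbs)

/-- **ES-34V `OddTwistModularDegreeShift` (IN PRINT modulo the Manin constant; m-currency).**  For optimal parametrisations of
`E` and of its twist `E ⊗ χ_{p*}` by an odd prime `p` at which `E` is `p`-twist-minimal:
`v₂(m_{E ⊗ χ}) = v₂(m_E) + v₂(V_p)`.  Watkins 2002 §2.1 (`V_p`, from Zagier 1985) with `c_E = c_{E⊗χ}`; ENGINE 34: exact on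
16 360 / 16 360 (minimal-twist, twist) pairs with `N ≤ 10⁴` (all `p ∣ D` at once, `p = 2` included with Watkins' `V₂`).
Filed as the SHAPE of the Literature fact the lens asks for; why it might fail as typed: unequal Manin constants in a pair.
[cite: Watkins2002ModularDegree, §2.1; Zagier1985ModularParametrizations] -/
def OddTwistModularDegreeShift : Prop :=
  ∀ (W : WeierstrassCurve ℚ) [W.IsElliptic] [W.IsGloballyMinimal] (p : ℕ)
    [(W.quadraticTwist (primeStar p : ℚ)).IsElliptic] [NeZero (W.conductorNorm ℤ)]
    [NeZero ((W.quadraticTwist (primeStar p : ℚ)).conductorNorm ℤ)]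
    (D : ModularParametrizationData W (W.conductorNorm ℤ))
    (D' : ModularParametrizationData (W.quadraticTwist (primeStar p : ℚ)) ((W.quadraticTwist (primeStar p : ℚ)).conductorNorm ℤ)),
    p.Prime → p ≠ 2 →
    (∀ (W'' : WeierstrassCurve ℚ) [W''.IsElliptic] (D'' : ModularParametrizationData W'' (W.conductorNorm ℤ)),
        D''.f = D.f → D.modularDegree ≤ D''.modularDegree) →
    (∀ (W'' : WeierstrassCurve ℚ) [W''.IsElliptic]
        (D'' : ModularParametrizationData W'' ((W.quadraticTwist (primeStar p : ℚ)).conductorNorm ℤ)),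
        D''.f = D'.f → D'.modularDegree ≤ D''.modularDegree) →
    W.conductorNorm ℤ ≤ (W.quadraticTwist (primeStar p : ℚ)).conductorNorm ℤ →
    padicValNat 2 D'.modularDegree = padicValNat 2 D.modularDegree + oddTwistShift W (W.conductorNorm ℤ) p

/-- **ES-34W `OddTwistCongruenceNumberShift` (this lens, -es g25; conjecture beyond print, r-currency).**  For a non-CM `E/ℚ`
with `ρ̄_{E,2}` surjective and `v₂(N) ≠ 2`, and an odd prime `p` at which `E` is `p`-twist-minimal, the congruence numbers of
`f_E` and `f_{E ⊗ χ_{p*}}` satisfy `v₂(r_{E⊗χ}) = v₂(r_E) + v₂(V_p)` — Wiles' level-raising factor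
`c_p = (p−1)(p+1−a_p)(p+1+a_p)` governs the congruence module at `ℓ = 2` EXACTLY; equivalently the Agashe–Ribet–Stein defect
`v₂(r/m)` is an invariant of the odd-twist class.  ENGINE 34: 838 `S₃` pairs with both `r` known — 831 exact, the 7 exceptions
are exactly the pairs at `v₂(N) = 2` whose minimal member is an ES-33C dip and whose twist is not (`2300b1/92b1`, `1116e1/124a1`,
`1044e1/348a1`, …); at `v₂(N) ∈ {0,1,3,5,7,8}`: 728 / 728.  Outside the `S₃` frame it fails (`1152p1/384a1`, Borel image, `v = 7`).
Why it might fail: a multiplicity-one failure of `𝕋_𝔪` at `2` away from `4 ∥ N` (none seen `N ≤ 10⁴`), where Ihara's lemma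
gives only `≥`. [cite: Watkins2002ModularDegree, §2.1; CornellSilvermanStevens1997FLT, p. 435 Lemma 4.4 + §4.3 (`η_Σ' ⊂ c_p η_Σ`, `ℓ` odd); AgasheRibetStein2012] -/
@[conjecture] def OddTwistCongruenceNumberShift : Prop :=
  ∀ (W : WeierstrassCurve ℚ) [W.IsElliptic] [W.IsGloballyMinimal] (p : ℕ)
    [(W.quadraticTwist (primeStar p : ℚ)).IsElliptic] [NeZero (W.conductorNorm ℤ)]
    [NeZero ((W.quadraticTwist (primeStar p : ℚ)).conductorNorm ℤ)]
    (D : ModularParametrizationData W (W.conductorNorm ℤ))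
    (D' : ModularParametrizationData (W.quadraticTwist (primeStar p : ℚ)) ((W.quadraticTwist (primeStar p : ℚ)).conductorNorm ℤ)),
    p.Prime → p ≠ 2 → ¬ W.HasCM → W.HasSurjectiveModNGaloisRep ((2 : ℕ) : ℤ) →
    padicValNat 2 (W.conductorNorm ℤ) ≠ 2 →
    W.conductorNorm ℤ ≤ (W.quadraticTwist (primeStar p : ℚ)).conductorNorm ℤ →
    padicValNat 2 (congruenceNumber D'.f) = padicValNat 2 (congruenceNumber D.f) + oddTwistShift W (W.conductorNorm ℤ) p

/-! ## ES-34T — the Agashe–Ribet–Stein defect of the 2-adic twists of semistable curves (conjecture; exact rows) -/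

/-- **ES-34T `ARSDefectOfSemistableTwistAtSixteen` (this lens, -es g25; conjecture).**  If `E` is optimal with `2⁴ ∥ N_E` and
its twist by `−1` has conductor not divisible by `4` (i.e. `E = F ⊗ χ₋₄` with `F` good or multiplicative at `2`), then
`v₂(r_E) = v₂(m_E) + 1` — the ARS defect is EXACTLY `1` (ARS allow `0 … 2`).  ENGINE 34: every such curve with `r` known,
`N ≤ 10⁴` (`F` good at `2`: 49 / 49; `F` multiplicative at `2`: 183 / 183, every image type).  Companion rows (not typed):
`2⁶ ∥ N`, `F` multiplicative: defect `2` (38 / 38); `F` good: defect `3` (4 / 4).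
Why it might fail: a curve `2⁴ ∥ N` twisted from a semistable one with `𝕋` Gorenstein-defect `≠ 1` at `2` beyond `10⁴`.
[cite: AgasheRibetStein2012, Thm 2.1 + Conj.; Watkins2002ModularDegree, §2.1.1] -/
@[conjecture] def ARSDefectOfSemistableTwistAtSixteen : Prop :=
  ∀ (W : WeierstrassCurve ℚ) [W.IsElliptic] [W.IsGloballyMinimal] [NeZero (W.conductorNorm ℤ)]
    [(W.quadraticTwist (-1 : ℚ)).IsElliptic]
    (D : ModularParametrizationData W (W.conductorNorm ℤ)),
    (∀ (W'' : WeierstrassCurve ℚ) [W''.IsElliptic] (D'' : ModularParametrizationData W'' (W.conductorNorm ℤ)),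
        D''.f = D.f → D.modularDegree ≤ D''.modularDegree) →
    padicValNat 2 (W.conductorNorm ℤ) = 4 → ¬ 4 ∣ (W.quadraticTwist (-1 : ℚ)).conductorNorm ℤ →
    padicValNat 2 (congruenceNumber D.f) = padicValNat 2 D.modularDegree + 1

/-! ## Glue (kernel-checked bookkeeping) -/

theorem twoAdicDegreeUnit_le_congruenceUnit (v : ℕ) : twoAdicDegreeUnit v ≤ twoAdicCongruenceUnit v := by
  unfold twoAdicDegreeUnit twoAdicCongruenceUnit
  split_ifs <;> omega

/-- One multiplicative unit per odd prime: with no additive odd prime the odd unit sum is the flat Atkin–Lehner count. -/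
theorem localDegreeUnit_of_not_sq_dvd (W : WeierstrassCurve ℚ) {N p : ℕ} (h : ¬ p ^ 2 ∣ N) :
    localDegreeUnit W N p = 1 := by
  simp [localDegreeUnit, h]

/-- The torus unit is at least `1` for an odd prime `p` (both `p − 1` and `p + 1` are even). -/
theorem one_le_torusUnitAt (W : WeierstrassCurve ℚ) {p : ℕ} (hp : p.Prime) (hp2 : p ≠ 2) : 1 ≤ torusUnitAt W p := by
  have hodd : Odd p := hp.odd_of_ne_two hp2
  obtain ⟨k, hk⟩ := hodd
  unfold torusUnitAt
  have h2 : Nat.Prime 2 := Nat.prime_two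
  haveI : Fact (Nat.Prime 2) := ⟨h2⟩
  split_ifs
  · have : 2 ∣ p - 1 := ⟨k, by omega⟩
    have hne : p - 1 ≠ 0 := by have := hp.two_le; omega
    exact (padicValNat_dvd_iff_le hne).mp (by simpa using this)
  · have : 2 ∣ p + 1 := ⟨k + 1, by omega⟩
    exact (padicValNat_dvd_iff_le (by omega)).mp (by simpa using this)

end Summit.BirchSwinnertonDyer.BirchSwinnertonDyer.Theorems.RankOneAtTwoSymSquareAnatomy
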